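import Summits.HubbardSuperconductivity.HubbardSuperconductivity.Theorems.AnisotropyChordKnnMLR
import Summits.HubbardSuperconductivity.HubbardSuperconductivity.Theorems.AnisotropyChordKnnTopSectors

/-!
# Route `AnisotropyChord` / H0 rotor rung, K_{n,n} sibling of XY-LM₀: a kernel-checkable CERTIFICATE for the budget
# condition (S_M) at rational anisotropy
(prover seat `hubbard-h0-rotor-p1` g13; replaces the theory seat's Python/exact-rational certificates (memo ROTOR-THEORY-11
§166, cycle11/knncert) by a Lean `Bool` checker + soundness theorem; director ruling CYCLE 12 (B) «in-Lean on exact rationals»)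

(S_M) says `λ_max(P_M(η)) − λ_max(P_{M+1}(η)) ≤ budget`.  Certificate `(u, ℓ, v, s)` over `ℚ`:
* UPPER: `u I − P_M ⪰ 0` by the tridiagonal pivots `d₀ = u − p₀`, `d_{k+1} = u − p_{k+1} − c_k²/d_k`, all `> 0` — the squared
  couplings `c_k² = (η/4)² b²_{J_k} b²_{J_k+1}` are RATIONAL (`quadForm_le_of_pivots`, an LDLᵀ sum of squares);
* LOWER: a non-negative rational test vector `v` for `P_{M+1}` with rational square-root minorants `s_k ≤ b_{J_k} b_{J_k+1}`
  (`s_k ≥ 0`, `s_k² ≤ b² b²`) and `ℓ‖v‖² ≤ Σ p_k v_k² + 2Σ (η/4) s_k v_k v_{k+1}` ⇒ `ℓ ≤ λ_max(P_{M+1})`;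
* `u − ℓ ≤ budget`.  `checkCert … = true → BudgetCondition n M η` (`budgetCondition_of_checkCert`); instances by `decide`.
-/

set_option linter.dupNamespace false
set_option autoImplicit false

open Finset Matrix

namespace Summit.HubbardSuperconductivity.HubbardSuperconductivity.Theorems.AnisotropyChord.Knn

/-! ## `ℚ` mirror of the block data -/

/-- `β_J²` over `ℚ`. [folklore] -/
def betaSqQ (n J : ℕ) : ℚ := (((n : ℚ) + 1) ^ 2 - ((J : ℚ) + 1) ^ 2) / ((2 * (J : ℚ) + 1) * (2 * (J : ℚ) + 3))

/-- `b_J(M)²` over `ℚ`. [folklore] -/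
def bSqQ (n : ℕ) (M : ℤ) (J : ℕ) : ℚ :=
  if J + 1 ≤ n then (((J : ℚ) + 1) ^ 2 - (M : ℚ) ^ 2) * betaSqQ n J else 0

/-- `b²_{J−1}` over `ℚ`. [folklore] -/
def bSqPredQ (n : ℕ) (M : ℤ) (J : ℕ) : ℚ := if J = 0 then 0 else bSqQ n M (J - 1)

/-- diagonal `p_k(M)` over `ℚ`. [folklore] -/
def pKQ (n : ℕ) (M : ℤ) (η : ℚ) (k : ℕ) : ℚ :=
  (lev n M k : ℚ) * ((lev n M k : ℚ) + 1) / 2 + η / 4 * (bSqPredQ n M (lev n M k) + bSqQ n M (lev n M k))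

/-- squared coupling `c_k(M)² = (η/4)² b²_{J_k} b²_{J_k+1}` over `ℚ` (rational!). [folklore] -/
def c2Q (n : ℕ) (M : ℤ) (η : ℚ) (k : ℕ) : ℚ := (η / 4) ^ 2 * (bSqQ n M (lev n M k) * bSqQ n M (lev n M k + 1))

/-- the budget `d_{2s−2}(M)` over `ℚ`. [folklore] -/
def budgetQ (n M : ℕ) (η : ℚ) : ℚ := η / 4 * (2 * (M : ℚ) + 1) * (betaSqQ n (n - 3) + betaSqQ n (n - 2))

/-- cast of `betaSqQ`. [folklore] -/
theorem cast_betaSqQ (n J : ℕ) : ((betaSqQ n J : ℚ) : ℝ) = betaSq n J := by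
  unfold betaSqQ betaSq; push_cast; ring

/-- cast of `bSqQ`. [folklore] -/
theorem cast_bSqQ (n : ℕ) (M : ℤ) (J : ℕ) : ((bSqQ n M J : ℚ) : ℝ) = bSq n M J := by
  unfold bSqQ bSq; split_ifs <;> push_cast <;> simp [cast_betaSqQ]

/-- cast of `bSqPredQ`. [folklore] -/
theorem cast_bSqPredQ (n : ℕ) (M : ℤ) (J : ℕ) : ((bSqPredQ n M J : ℚ) : ℝ) = bSqPred n M J := by
  unfold bSqPredQ bSqPred; split_ifs <;> simp [cast_bSqQ]

/-- cast of `pKQ`. [folklore] -/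
theorem cast_pKQ (n : ℕ) (M : ℤ) (η : ℚ) (k : ℕ) : ((pKQ n M η k : ℚ) : ℝ) = pK n M (η : ℝ) k := by
  unfold pKQ pK; push_cast; rw [cast_bSqPredQ, cast_bSqQ]

/-- cast of `c2Q` is the square of the real coupling. [folklore] -/
theorem cast_c2Q (n : ℕ) (M : ℤ) (η : ℚ) (k : ℕ) : ((c2Q n M η k : ℚ) : ℝ) = cK n M (η : ℝ) k ^ 2 := by
  unfold c2Q cK
  have h1 : 0 ≤ bSq n M (lev n M k) := bSq_nonneg (by have := natAbs_le_lev n M k; omega)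
  have h2 : 0 ≤ bSq n M (lev n M k + 1) := bSq_nonneg (by have := natAbs_le_lev n M k; omega)
  push_cast
  rw [cast_bSqQ, cast_bSqQ, mul_pow, Real.sq_sqrt (mul_nonneg h1 h2)]

/-- cast of `budgetQ`. [folklore] -/
theorem cast_budgetQ (n M : ℕ) (η : ℚ) : ((budgetQ n M η : ℚ) : ℝ) = budget n M (η : ℝ) := by
  unfold budgetQ budget; push_cast; rw [cast_betaSqQ, cast_betaSqQ]

/-! ## UPPER bound: tridiagonal pivots (LDLᵀ) -/

/-- the pivots `d₀ = u − p₀`, `d_{k+1} = u − p_{k+1} − c_k²/d_k` of `u I − P`. [folklore] -/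
noncomputable def pivot (p c2 : ℕ → ℝ) (u : ℝ) : ℕ → ℝ
  | 0 => u - p 0
  | k + 1 => u - p (k + 1) - c2 k / pivot p c2 u k

/-- the same recursion over `ℚ` for the `K_{n,n}` block. [folklore] -/
def pivotQ (n : ℕ) (M : ℤ) (η u : ℚ) : ℕ → ℚ
  | 0 => u - pKQ n M η 0
  | k + 1 => u - pKQ n M η (k + 1) - c2Q n M η k / pivotQ n M η u k

/-- cast of `pivotQ`. [folklore] -/
theorem cast_pivotQ (n : ℕ) (M : ℤ) (η u : ℚ) (k : ℕ) :
    ((pivotQ n M η u k : ℚ) : ℝ) = pivot (pK n M (η : ℝ)) (fun j => cK n M (η : ℝ) j ^ 2) (u : ℝ) k := by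
  induction k with
  | zero => simp [pivotQ, pivot, cast_pKQ]
  | succ k ih => simp only [pivotQ, pivot]; push_cast; rw [cast_pKQ, cast_c2Q, ih]

/-- **LDLᵀ identity/inequality:** if all pivots are positive then `Σ_{k<m} ((u − p_k) e_k² − 2 c_k e_k e_{k+1}) ≥ 0` whenever
`e_m = 0` (sum of the squares `d_k (e_k − (c_k/d_k) e_{k+1})²`). [folklore] -/
theorem pivot_sum_nonneg (p c : ℕ → ℝ) (u : ℝ) (m : ℕ)
    (hpiv : ∀ k, k < m → 0 < pivot p (fun j => c j ^ 2) u k) (e : ℕ → ℝ) (hem : e m = 0) :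
    0 ≤ ∑ k ∈ range m, ((u - p k) * e k ^ 2 - 2 * c k * e k * e (k + 1)) := by
  set d := pivot p (fun j => c j ^ 2) u with hd
  -- S(m) − T(m) = −(c_{m−1}²/d_{m−1}) e_m²  (telescoping through the recursion)
  have key : ∀ m', (∀ k, k < m' → 0 < d k) →
      ∑ k ∈ range m', ((u - p k) * e k ^ 2 - 2 * c k * e k * e (k + 1))
        = ∑ k ∈ range m', d k * (e k - c k / d k * e (k + 1)) ^ 2
          - (if m' = 0 then 0 else c (m' - 1) ^ 2 / d (m' - 1) * e m' ^ 2) := by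
    intro m'
    induction m' with
    | zero => intro _; simp
    | succ j ih =>
      intro hj
      have ih' := ih (fun k hk => hj k (by omega))
      rw [Finset.sum_range_succ, Finset.sum_range_succ, ih']
      simp only [Nat.succ_ne_zero, if_false, Nat.add_sub_cancel]
      have hdj : d j ≠ 0 := (hj j (by omega)).ne'
      rcases Nat.eq_zero_or_pos j with hj0 | hjpos
      · subst hj0
        simp only [if_true, Finset.sum_range_zero]
        have e0 : d 0 = u - p 0 := by rw [hd]; rfl
        field_simp
        rw [e0]; ring
      · rw [if_neg (by omega)]
        obtain ⟨i, rfl⟩ : ∃ i, j = i + 1 := ⟨j - 1, by omega⟩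
        simp only [Nat.add_sub_cancel]
        have hdi : d i ≠ 0 := (hj i (by omega)).ne'
        have es : d (i + 1) = u - p (i + 1) - c i ^ 2 / d i := by rw [hd]; rfl
        field_simp
        rw [es]; field_simp; ring
  rw [key m hpiv, hem]
  simp only [ne_eq, zero_pow, OfNat.ofNat_ne_zero, not_false_eq_true, mul_zero, ite_self, sub_zero]
  exact Finset.sum_nonneg fun k hk => mul_nonneg (hpiv k (mem_range.mp hk)).le (sq_nonneg _)

/-- **upper bound from positive pivots:** `⟨y, P y⟩ ≤ u ⟨y, y⟩` for every `y`. [folklore] -/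
theorem quadForm_le_of_pivots {m : ℕ} (p c : ℕ → ℝ) (u : ℝ)
    (hpiv : ∀ k, k < m → 0 < pivot p (fun j => c j ^ 2) u k) (y : Fin m → ℝ) :
    y ⬝ᵥ (jac m p c *ᵥ y) ≤ u * (y ⬝ᵥ y) := by
  have h := pivot_sum_nonneg p c u m hpiv (ext0 y) (ext0_self y)
  rw [jac_quadForm, ← sum_range_ext0_sq, Finset.mul_sum]
  have : ∑ k ∈ range m, ((u - p k) * ext0 y k ^ 2 - 2 * c k * ext0 y k * ext0 y (k + 1))
      = ∑ k ∈ range m, u * ext0 y k ^ 2 - ∑ k ∈ range m, (p k * ext0 y k ^ 2 + 2 * c k * ext0 y k * ext0 y (k + 1)) := by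
    rw [← Finset.sum_sub_distrib]; apply Finset.sum_congr rfl; intro k _; ring
  linarith

/-- … hence `rayleigh ≤ u` for any non-zero vector. [folklore] -/
theorem rayleigh_le_of_pivots {m : ℕ} (p c : ℕ → ℝ) (u : ℝ)
    (hpiv : ∀ k, k < m → 0 < pivot p (fun j => c j ^ 2) u k) {x : Fin m → ℝ} (hx : x ≠ 0) :
    rayleigh (jac m p c) x ≤ u := by
  have h := quadForm_le_of_pivots p c u hpiv x
  rw [rayleigh, div_le_iff₀ (dotProduct_self_pos_of_ne_zero hx)]
  exact h

/-! ## LOWER bound: a non-negative test vector with square-root minorants -/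

/-- `ℓ ≤ rayleigh(x)` for a top vector `x`, from any test vector `y ≠ 0` with `ℓ‖y‖² ≤ ⟨y, A y⟩`. [folklore] -/
theorem le_rayleigh_of_testVector {m : ℕ} {A : Matrix (Fin m) (Fin m) ℝ} {x : Fin m → ℝ} (hx : IsTopVector A x)
    {y : Fin m → ℝ} (hy : y ≠ 0) {ℓ : ℝ} (h : ℓ * (y ⬝ᵥ y) ≤ y ⬝ᵥ (A *ᵥ y)) : ℓ ≤ rayleigh A x := by
  have hxx := dotProduct_self_pos_of_ne_zero hx.1
  have hyy := dotProduct_self_pos_of_ne_zero hy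
  have h2 := hx.2.2 y
  rw [rayleigh, le_div_iff₀ hxx]
  nlinarith

/-- structural range sum (kernel-friendly). [folklore] -/
def rsum (f : ℕ → ℚ) : ℕ → ℚ
  | 0 => 0
  | m + 1 => rsum f m + f m

/-- `rsum = Finset.sum range`. [folklore] -/
theorem rsum_eq (f : ℕ → ℚ) (m : ℕ) : rsum f m = ∑ k ∈ range m, f k := by
  induction m with
  | zero => simp [rsum]
  | succ m ih => rw [rsum, ih, Finset.sum_range_succ]

/-- entries of a rational list as a function (`0` beyond the end). [folklore] -/
def vecQ (v : List ℚ) (k : ℕ) : ℚ := v.getD k 0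

/-- `vecQ v k = 0` beyond the length. [folklore] -/
theorem vecQ_of_le {v : List ℚ} {k : ℕ} (hk : v.length ≤ k) : vecQ v k = 0 := by
  unfold vecQ; rw [List.getD_eq_getElem?_getD, List.getElem?_eq_none hk]; rfl

/-! ## The checker -/

/-- UPPER check: all pivots of `u I − P_M(η)` positive. [folklore] -/
def upperOK (n : ℕ) (M : ℤ) (η u : ℚ) : Bool :=
  (List.range (numLevels n M)).all fun k => decide (0 < pivotQ n M η u k)

/-- LOWER check for the block `P_M(η)`: test vector `v ≥ 0` of the right length, minorants `s`, and the Rayleigh bound. [folklore] -/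
def lowerOK (n : ℕ) (M : ℤ) (η ℓ : ℚ) (v s : List ℚ) : Bool :=
  decide (v.length = numLevels n M)
  && ((List.range (numLevels n M)).all fun k => decide (0 ≤ vecQ v k))
  && ((List.range (numLevels n M)).all fun k =>
        decide (0 ≤ vecQ s k) && decide (vecQ s k ^ 2 ≤ bSqQ n M (lev n M k) * bSqQ n M (lev n M k + 1)))
  && decide (0 < rsum (fun k => vecQ v k ^ 2) (numLevels n M))
  && decide (ℓ * rsum (fun k => vecQ v k ^ 2) (numLevels n M)
        ≤ rsum (fun k => pKQ n M η k * vecQ v k ^ 2 + 2 * (η / 4 * vecQ s k) * vecQ v k * vecQ v (k + 1))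
            (numLevels n M))

/-- **the certificate checker for (S_M):** pivots for `P_M`, test vector for `P_{M+1}`, and `u − ℓ ≤ budget`. [folklore] -/
def checkCert (n M : ℕ) (η u ℓ : ℚ) (v s : List ℚ) : Bool :=
  upperOK n (M : ℤ) η u && lowerOK n ((M : ℤ) + 1) η ℓ v s && decide (u - ℓ ≤ budgetQ n M η)

/-! ## Soundness -/

/-- soundness of the UPPER check. [folklore] -/
theorem rayleigh_le_of_upperOK {n : ℕ} {M : ℤ} {η u : ℚ} (h : upperOK n M η u = true)
    {x : Fin (numLevels n M) → ℝ} (hx : x ≠ 0) :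
    rayleigh (knnBlock n M (η : ℝ)) x ≤ (u : ℝ) := by
  rw [knnBlock_eq_jac]
  apply rayleigh_le_of_pivots _ _ _ _ hx
  intro k hk
  unfold upperOK at h
  rw [List.all_eq_true] at h
  have hk' := h k (List.mem_range.mpr hk)
  rw [decide_eq_true_eq] at hk'
  rw [← cast_pivotQ]
  exact_mod_cast hk'

/-- soundness of the LOWER check. [folklore] -/
theorem le_rayleigh_of_lowerOK {n : ℕ} {M : ℤ} {η ℓ : ℚ} {v s : List ℚ} (hη : 0 ≤ η)
    (h : lowerOK n M η ℓ v s = true) {x : Fin (numLevels n M) → ℝ} (hx : IsTopVector (knnBlock n M (η : ℝ)) x) :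
    (ℓ : ℝ) ≤ rayleigh (knnBlock n M (η : ℝ)) x := by
  unfold lowerOK at h
  simp only [Bool.and_eq_true, List.all_eq_true, List.mem_range, decide_eq_true_eq] at h
  obtain ⟨⟨⟨⟨hlen, hvnn⟩, hs⟩, hpos⟩, hray⟩ := h
  set m := numLevels n M with hm
  -- the real test vector
  set y : Fin m → ℝ := fun i => (vecQ v i : ℝ) with hy
  have hey : ∀ k, ext0 y k = (vecQ v k : ℝ) := by
    intro k; unfold ext0
    split_ifs with hk
    · rfl
    · rw [vecQ_of_le (by rw [hlen]; omega)]; simp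
  have hyy : y ⬝ᵥ y = ((rsum (fun k => vecQ v k ^ 2) m : ℚ) : ℝ) := by
    rw [← sum_range_ext0_sq, rsum_eq]; push_cast
    apply Finset.sum_congr rfl; intro k _; rw [hey]
  have hy0 : y ≠ 0 := by
    intro h0
    have : y ⬝ᵥ y = 0 := by rw [h0, dotProduct_zero]
    rw [hyy] at this
    have : rsum (fun k => vecQ v k ^ 2) m = 0 := by exact_mod_cast this
    linarith
  apply le_rayleigh_of_testVector hx hy0
  rw [hyy, knnBlock_eq_jac, jac_quadForm]
  -- compare term by term with the rational lower sum
  have hcmp : ∀ k, k < m → ((pKQ n M η k * vecQ v k ^ 2 + 2 * (η / 4 * vecQ s k) * vecQ v k * vecQ v (k + 1) : ℚ) : ℝ)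
      ≤ pK n M (η : ℝ) k * ext0 y k ^ 2 + 2 * cK n M (η : ℝ) k * ext0 y k * ext0 y (k + 1) := by
    intro k hk
    push_cast
    rw [cast_pKQ, hey, hey]
    have hsk := hs k hk
    have hs0 : (0 : ℝ) ≤ (vecQ s k : ℝ) := by exact_mod_cast hsk.1
    have hsle : (η : ℝ) / 4 * (vecQ s k : ℝ) ≤ cK n M (η : ℝ) k := by
      unfold cK
      apply mul_le_mul_of_nonneg_left _ (by positivity)
      have h2 : ((vecQ s k : ℚ) : ℝ) ^ 2 ≤ bSq n M (lev n M k) * bSq n M (lev n M k + 1) := by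
        rw [← cast_bSqQ, ← cast_bSqQ]; exact_mod_cast hsk.2
      calc ((vecQ s k : ℚ) : ℝ) = Real.sqrt (((vecQ s k : ℚ) : ℝ) ^ 2) := (Real.sqrt_sq hs0).symm
        _ ≤ Real.sqrt (bSq n M (lev n M k) * bSq n M (lev n M k + 1)) := Real.sqrt_le_sqrt h2
    have hvk : (0 : ℝ) ≤ (vecQ v k : ℝ) := by exact_mod_cast hvnn k hk
    have hvk1 : (0 : ℝ) ≤ (vecQ v (k + 1) : ℝ) := by
      by_cases hk1 : k + 1 < m
      · exact_mod_cast hvnn (k + 1) hk1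
      · rw [vecQ_of_le (by rw [hlen]; omega)]; simp
    have : 2 * ((η : ℝ) / 4 * (vecQ s k : ℝ)) * (vecQ v k : ℝ) * (vecQ v (k + 1) : ℝ)
        ≤ 2 * cK n M (η : ℝ) k * (vecQ v k : ℝ) * (vecQ v (k + 1) : ℝ) := by
      have hvv : 0 ≤ (vecQ v k : ℝ) * (vecQ v (k + 1) : ℝ) := mul_nonneg hvk hvk1
      nlinarith
    linarith
  have hsum : (((rsum (fun k => pKQ n M η k * vecQ v k ^ 2 + 2 * (η / 4 * vecQ s k) * vecQ v k * vecQ v (k + 1)) m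
      : ℚ)) : ℝ) ≤ ∑ k ∈ range m, (pK n M (η : ℝ) k * ext0 y k ^ 2 + 2 * cK n M (η : ℝ) k * ext0 y k * ext0 y (k + 1)) := by
    rw [rsum_eq]; push_cast
    exact Finset.sum_le_sum fun k hk => by
      have := hcmp k (mem_range.mp hk); push_cast at this; exact this
  have hray' : ((ℓ : ℚ) : ℝ) * ((rsum (fun k => vecQ v k ^ 2) m : ℚ) : ℝ)
      ≤ ((rsum (fun k => pKQ n M η k * vecQ v k ^ 2 + 2 * (η / 4 * vecQ s k) * vecQ v k * vecQ v (k + 1)) m : ℚ) : ℝ) := by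
    exact_mod_cast hray
  linarith

/-- **SOUNDNESS: a passing certificate proves the budget condition (S_M).** [folklore] -/
theorem budgetCondition_of_checkCert {n M : ℕ} {η u ℓ : ℚ} {v s : List ℚ} (hη : 0 ≤ η)
    (h : checkCert n M η u ℓ v s = true) : BudgetCondition n M (η : ℝ) := by
  unfold checkCert at h
  simp only [Bool.and_eq_true, decide_eq_true_eq] at h
  obtain ⟨⟨hup, hlow⟩, hb⟩ := h
  intro x x' hx hx'
  have h1 := rayleigh_le_of_upperOK hup hx.1
  have h2 := le_rayleigh_of_lowerOK hη hlow hx'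
  have h3 : ((u : ℝ)) - (ℓ : ℝ) ≤ budget n M (η : ℝ) := by
    rw [← cast_budgetQ]; exact_mod_cast hb
  linarith

end Summit.HubbardSuperconductivity.HubbardSuperconductivity.Theorems.AnisotropyChord.Knn
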